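import Summits.PneNP.PneNP.Theorems.RankOneQuadAvoidFPCorrect
import Literature.Computability.Complexity.SignDegreeXor

/-!
# Linearisation: pure `P⋆` range avoidance is in FP when the AND pairs are few (rung R20-lin) — machine and correctness

FRONTIER range-avoidance ladder, cell `pnp-ideate`, ROUND-20 (planner seat p3's seed §5, item R20-lin; restricted-model
algorithmics — nothing here bears on `P` versus `NP`).

A pure `P⋆` instance `I : LocalMap 4 n m` computes `y_j = x_{a_j} ⊕ x_{b_j} ⊕ x_{c_j}·x_{d_j}`.  Over `𝔽₂` every output is a
LINEAR form in the MONOMIAL VECTOR `z(x) = ((x_v)_{v<n}, (x_{c_j} x_{d_j})_j)`, and the monomial coordinates actually used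
are `n` variables plus one coordinate per DISTINCT AND pair `{c_j, d_j}`.  So if `m > n + #{distinct AND pairs}` the `m`
rows `e_{a_j} + e_{b_j} + e_{pair(j)}` are linearly dependent: Gaussian elimination finds the first output `j⋆` whose row
lies in the span of the earlier rows, and then the indicator string `e_{j⋆}` is outside `Range(I)` (pairing with `z(x)`
kills every earlier row, hence their span, hence row `j⋆` — but bit `j⋆` was printed `1`).  This is the LINEARISATION
certificate (ROUND-19 no-go N1 turned into the positive rung it does give): the class

  `LinearisablePstar I := I.IsPure xorAndPred ∧ n + numAndPairs I < m`

is solved at every stretch by ONE string function `linStr` (this file: the AND-pair count, the program on the decoder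
`LocalMapDecodeFP.decode`, what it prints on a genuine code, and its CORRECTNESS `linStr_correct`; the sequel
`PstarLinearisationFP` types it in the `CodeFP` algebra, names the class and proves the rung
`LocalAvoidLinearFP 4 LinearisablePstar`).
The span test and the first-dependent-row search are the tree's `Nc03Reduction.inSpan` / `AffineSplitFP.tStar`, here
driven by a dimension count inside a coordinate subspace (`tStar_spec_of_finrank`) instead of the full space.
-/

set_option linter.dupNamespace false -- `Summit.PneNP.PneNP.…`: summit = sub-problem name (D-0017 single-conjunct layout)

namespace Summit.PneNP.PneNP.Theorems.PstarLinearisation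

open Finset Literature.Computability.Complexity
open Summit.PneNP.PneNP.Theorems.MajLocalAvoidFP (rowOf length_rowOf getD_rowOf)
open Summit.PneNP.PneNP.Theorems.LocalMapDecodeFP (tabOf outsOf decode decode_encode hdrN hdrN_encode)
open Summit.PneNP.PneNP.Theorems.Nc03Reduction (inSpan inSpan_iff Vec vecL vecL_nil vecL_trip ind bit bit_add bit_eq_zero)
open Summit.PneNP.PneNP.Theorems.AffineSplitFP (tStar dot_eq_zero_of_mem_span mem_take_map)
open Summit.PneNP.PneNP.Theorems.RankOneQuadAvoidFP (dot_ind)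

variable {n m : ℕ}

/-! ## The AND pairs -/

/-- The AND pair `{c_j, d_j}` of output `j` (slots `2, 3` of `xorAndPred`), as an unordered pair — an edge of the
AND multigraph `G_A`. -/
def andEdge (I : LocalMap 4 n m) (j : Fin m) : Sym2 (Fin n) := s(I.vars j 2, I.vars j 3)

/-- The number of DISTINCT AND pairs of an instance (edges of the simple graph underlying `G_A`) — the number of
quadratic monomials `x_c x_d` occurring in the output polynomials. -/
def numAndPairs (I : LocalMap 4 n m) : ℕ := (univ.image (andEdge I)).card

/-! ## The program (on the output of the decoder `LocalMapDecodeFP.decode 4`) -/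

/-- Normal form `(min(c,d), max(c,d))` of the AND pair of a decoded position list `[a, b, c, d]`. -/
def pairKey (pos : List ℕ) : ℕ × ℕ := (min (pos.getD 2 0) (pos.getD 3 0), max (pos.getD 2 0) (pos.getD 3 0))

/-- The AND-pair keys of all decoded outputs, in order. -/
def keysOf (outs : List (List Bool × List ℕ)) : List (ℕ × ℕ) := outs.map fun o => pairKey o.2

/-- The `𝔽₂`-row of a decoded output as an index list over the coordinates `v < N` (variables) and `N + j'`
(the AND monomial, named by the FIRST output `j'` with the same AND pair): `[a, b, N + j']`. -/
def linRowD (N : ℕ) (keys : List (ℕ × ℕ)) (o : List Bool × List ℕ) : List ℕ :=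
  [o.2.getD 0 0, o.2.getD 1 0, N + keys.findIdx fun κ => decide (κ = pairKey o.2)]

/-- The rows of all decoded outputs. -/
def rowsD (N : ℕ) (outs : List (List Bool × List ℕ)) : List (List ℕ) := outs.map (linRowD N (keysOf outs))

/-- The FIRST output whose row lies in the `𝔽₂`-span of the earlier rows (ambient dimension `N + #outputs`; the tree's
`AffineSplitFP.tStar` over the span test `Nc03Reduction.inSpan`). -/
def jLin (N : ℕ) (outs : List (List Bool × List ℕ)) : ℕ := tStar (N + outs.length) (rowsD N outs)

/-- The answer on decoded data: the indicator string `e_{jLin}`. -/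
def outLin (N : ℕ) (outs : List (List Bool × List ℕ)) : List Bool :=
  (List.range outs.length).map fun j => j == jLin N outs

/-- **THE MACHINE** `linStr`: decode, build the rows, find the first dependent one, print its indicator. -/
def linStr (w : List Bool) : List Bool := outLin (hdrN w) (decode 4 w)

/-! ## Semantics on the code of an instance -/

/-- The AND-pair key of output `j` on position VALUES: `(min(c_j,d_j), max(c_j,d_j))`. -/
def keyOf (I : LocalMap 4 n m) (j : Fin m) : ℕ × ℕ :=
  (min (I.vars j 2).val (I.vars j 3).val, max (I.vars j 2).val (I.vars j 3).val)

/-- The key read off an unordered pair of positions. -/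
def symKey : Sym2 (Fin n) → ℕ × ℕ :=
  Sym2.lift ⟨fun c d => (min c.val d.val, max c.val d.val), fun c d => by dsimp only; rw [min_comm, max_comm]⟩

/-- The key of an output is the key of its AND pair (so equal AND pairs give equal keys). -/
theorem keyOf_eq (I : LocalMap 4 n m) (j : Fin m) : keyOf I j = symKey (andEdge I j) := rfl

/-- Equal keys mean equal AND pairs up to order. -/
theorem minmax_eq {c d c' d' : ℕ} (h : (min c d, max c d) = (min c' d', max c' d')) :
    (c = c' ∧ d = d') ∨ (c = d' ∧ d = c') := by
  simp only [Prod.mk.injEq, Nat.min_def, Nat.max_def] at h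
  split_ifs at h <;> omega

/-- Outputs with equal keys have the same AND monomial. -/
theorem andVal_eq_of_keyOf_eq (I : LocalMap 4 n m) {j j' : Fin m} (h : keyOf I j = keyOf I j') (x : Fin n → Bool) :
    (x (I.vars j 2) && x (I.vars j 3)) = (x (I.vars j' 2) && x (I.vars j' 3)) := by
  rcases minmax_eq h with ⟨hc, hd⟩ | ⟨hc, hd⟩
  · rw [Fin.ext hc, Fin.ext hd]
  · rw [Fin.ext hc, Fin.ext hd, Bool.and_comm]

/-- The decoded key of output `j` is its key. -/
theorem pairKey_rowOf (I : LocalMap 4 n m) (j : Fin m) : pairKey (rowOf I j) = keyOf I j := by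
  have h2 : (rowOf I j).getD 2 0 = (I.vars j 2).val := getD_rowOf I j 2
  have h3 : (rowOf I j).getD 3 0 = (I.vars j 3).val := getD_rowOf I j 3
  unfold pairKey keyOf
  rw [h2, h3]

/-- The decoded keys of a genuine code. -/
theorem keysOf_outsOf (I : LocalMap 4 n m) : keysOf (outsOf I) = (List.finRange m).map (keyOf I) := by
  unfold keysOf outsOf
  rw [List.map_map]
  exact List.map_congr_left fun j _ => pairKey_rowOf I j

/-- The index of the FIRST output with the same AND pair as `j`. -/
def pidx (I : LocalMap 4 n m) (j : Fin m) : ℕ :=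
  ((List.finRange m).map (keyOf I)).findIdx fun κ => decide (κ = keyOf I j)

/-- That index is a genuine output index. -/
theorem pidx_lt (I : LocalMap 4 n m) (j : Fin m) : pidx I j < m := by
  have h : ((List.finRange m).map (keyOf I)).findIdx (fun κ => decide (κ = keyOf I j)) <
      ((List.finRange m).map (keyOf I)).length :=
    List.findIdx_lt_length_of_exists ⟨keyOf I j, List.mem_map.2 ⟨j, List.mem_finRange j, rfl⟩, by simp⟩
  rwa [List.length_map, List.length_finRange] at h

/-- The first output with the same AND pair as `j`, as an output index. -/
def pfin (I : LocalMap 4 n m) (j : Fin m) : Fin m := ⟨pidx I j, pidx_lt I j⟩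

/-- It has the same key. -/
theorem keyOf_pfin (I : LocalMap 4 n m) (j : Fin m) : keyOf I (pfin I j) = keyOf I j := by
  have hlt : ((List.finRange m).map (keyOf I)).findIdx (fun κ => decide (κ = keyOf I j)) <
      ((List.finRange m).map (keyOf I)).length := by
    rw [List.length_map, List.length_finRange]; exact pidx_lt I j
  have h := List.findIdx_getElem (xs := (List.finRange m).map (keyOf I)) (p := fun κ => decide (κ = keyOf I j)) (w := hlt)
  rw [List.getElem_map, List.getElem_finRange, decide_eq_true_eq] at h
  exact h

/-- Outputs with equal keys get the same index. -/
theorem pidx_congr {I : LocalMap 4 n m} {j j' : Fin m} (h : keyOf I j = keyOf I j') : pidx I j = pidx I j' := by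
  unfold pidx; rw [h]

/-- The row of output `j`: `[a_j, b_j, n + pidx j]`. -/
def linRow (I : LocalMap 4 n m) (j : Fin m) : List ℕ := [(I.vars j 0).val, (I.vars j 1).val, n + pidx I j]

/-- The machine's row of a genuine decoded output is that row. -/
theorem linRowD_out (I : LocalMap 4 n m) (j : Fin m) :
    linRowD n ((List.finRange m).map (keyOf I)) (tabOf I j, rowOf I j) = linRow I j := by
  have h0 : (rowOf I j).getD 0 0 = (I.vars j 0).val := getD_rowOf I j 0
  have h1 : (rowOf I j).getD 1 0 = (I.vars j 1).val := getD_rowOf I j 1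
  unfold linRowD linRow pidx
  rw [pairKey_rowOf]
  dsimp only
  rw [h0, h1]

/-- The machine's rows of a genuine code. -/
theorem rowsD_outsOf (I : LocalMap 4 n m) : rowsD n (outsOf I) = (List.finRange m).map (linRow I) := by
  unfold rowsD
  rw [keysOf_outsOf]
  unfold outsOf
  rw [List.map_map]
  exact List.map_congr_left fun j _ => linRowD_out I j

/-- A genuine code has `m` decoded outputs. -/
theorem length_outsOf (I : LocalMap 4 n m) : (outsOf I).length = m := by
  simp [outsOf]

/-- The dependent output index of a genuine instance. -/
def jL (I : LocalMap 4 n m) : ℕ := tStar (n + m) ((List.finRange m).map (linRow I))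

/-- The machine's dependent index on a genuine code. -/
theorem jLin_outsOf (I : LocalMap 4 n m) : jLin n (outsOf I) = jL I := by
  unfold jLin jL
  rw [length_outsOf, rowsD_outsOf]

/-- **What the machine prints on a genuine code**: bit `j` is `[j = jL I]`. -/
theorem readOut_linStr (I : LocalMap 4 n m) (j : Fin m) : readOut m (linStr I.encode) j = (j.val == jL I) := by
  unfold readOut linStr outLin
  rw [decode_encode, hdrN_encode, jLin_outsOf, length_outsOf, List.getD_eq_getElem?_getD, List.getElem?_map,
    List.getElem?_range j.isLt]
  rfl

/-! ## The outputs are linear forms in the monomial vector -/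

/-- The MONOMIAL VECTOR `z(x) ∈ 𝔽₂^{n+m}` of an input: coordinate `v < n` carries `x_v`, coordinate `n + j` carries the
AND monomial `x_{c_j} x_{d_j}` of output `j`. -/
def zvec (I : LocalMap 4 n m) (x : Fin n → Bool) : Vec (n + m) :=
  fun q => Fin.addCases (motive := fun _ => ZMod 2) (fun v => bit (x v)) (fun j => bit (x (I.vars j 2) && x (I.vars j 3))) q

/-- Variable coordinates of the monomial vector. -/
theorem zvec_castAdd (I : LocalMap 4 n m) (x : Fin n → Bool) (v : Fin n) : zvec I x (Fin.castAdd m v) = bit (x v) := by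
  unfold zvec; rw [Fin.addCases_left]

/-- Monomial coordinates of the monomial vector. -/
theorem zvec_natAdd (I : LocalMap 4 n m) (x : Fin n → Bool) (j : Fin m) :
    zvec I x (Fin.natAdd n j) = bit (x (I.vars j 2) && x (I.vars j 3)) := by
  unfold zvec; rw [Fin.addCases_right]

/-- The row of output `j` as a vector: `e_{a_j} + e_{b_j} + e_{n + pidx j}`. -/
theorem vecL_linRow (I : LocalMap 4 n m) (j : Fin m) :
    vecL (n + m) (linRow I j) =
      ind (Fin.castAdd m (I.vars j 0)) + ind (Fin.castAdd m (I.vars j 1)) + ind (Fin.natAdd n (pfin I j)) :=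
  vecL_trip (Fin.castAdd m (I.vars j 0)) (Fin.castAdd m (I.vars j 1)) (Fin.natAdd n (pfin I j))

/-- **Each output of a pure `P⋆` instance is LINEAR in the monomial vector**: `bit (y_j) = ⟨z(x), row_j⟩`. -/
theorem bit_eval (I : LocalMap 4 n m) (hI : I.IsPure xorAndPred) (x : Fin n → Bool) (j : Fin m) :
    bit (I.eval x j) = zvec I x ⬝ᵥ vecL (n + m) (linRow I j) := by
  rw [vecL_linRow, dotProduct_add, dotProduct_add, dot_ind, dot_ind, dot_ind, zvec_castAdd, zvec_castAdd, zvec_natAdd,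
    andVal_eq_of_keyOf_eq I (keyOf_pfin I j) x]
  show bit (I.table j fun i => x (I.vars j i)) = _
  rw [hI.1 j, xorAndPred_apply, ← bit_add, ← bit_add]

/-! ## The dimension count -/

/-- The monomial coordinates used by the rows number at most `#{distinct AND pairs}`: distinct first-occurrence indices
have distinct AND pairs. -/
theorem card_image_pfin_le (I : LocalMap 4 n m) : (univ.image (pfin I)).card ≤ numAndPairs I := by
  refine Finset.card_le_card_of_injOn (andEdge I) (fun j _ => mem_coe.2 (mem_image_of_mem _ (mem_univ _))) ?_
  intro j₁ hj₁ j₂ hj₂ h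
  obtain ⟨i₁, -, rfl⟩ := mem_image.1 (mem_coe.1 hj₁)
  obtain ⟨i₂, -, rfl⟩ := mem_image.1 (mem_coe.1 hj₂)
  have hk : keyOf I i₁ = keyOf I i₂ := by
    rw [← keyOf_pfin I i₁, ← keyOf_pfin I i₂, keyOf_eq, keyOf_eq, h]
  exact Fin.ext (pidx_congr hk)

/-- The coordinates used by the rows: the `n` variables and the first-occurrence monomial coordinates. -/
def usedCoords (I : LocalMap 4 n m) : Finset (Fin (n + m)) :=
  univ.image (Fin.castAdd m) ∪ (univ.image (pfin I)).image (Fin.natAdd n)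

/-- At most `n + #{distinct AND pairs}` coordinates are used. -/
theorem card_usedCoords_le (I : LocalMap 4 n m) : (usedCoords I).card ≤ n + numAndPairs I := by
  unfold usedCoords
  refine (card_union_le _ _).trans (add_le_add ?_ ?_)
  · exact card_image_le.trans (by rw [card_univ, Fintype.card_fin])
  · exact card_image_le.trans (card_image_pfin_le I)

/-- Every row lies in the span of the unit vectors of the used coordinates. -/
theorem vecL_linRow_mem (I : LocalMap 4 n m) (j : Fin m) :
    vecL (n + m) (linRow I j) ∈ Submodule.span (ZMod 2) (((usedCoords I).image ind : Finset (Vec (n + m))) : Set (Vec (n + m))) := by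
  rw [vecL_linRow]
  refine Submodule.add_mem _ (Submodule.add_mem _ ?_ ?_) ?_ <;> refine Submodule.subset_span (mem_coe.2 ?_) <;>
    refine mem_image_of_mem _ ?_ <;> unfold usedCoords
  · exact mem_union_left _ (mem_image_of_mem _ (mem_univ _))
  · exact mem_union_left _ (mem_image_of_mem _ (mem_univ _))
  · exact mem_union_right _ (mem_image_of_mem _ (mem_image_of_mem _ (mem_univ _)))

/-- **The rows span a space of dimension at most `n + #{distinct AND pairs}`.** -/
theorem finrank_rows_le (I : LocalMap 4 n m) :
    Module.finrank (ZMod 2) (Submodule.span (ZMod 2) (vecL (n + m) '' {r | r ∈ (List.finRange m).map (linRow I)})) ≤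
      n + numAndPairs I := by
  have hle : Submodule.span (ZMod 2) (vecL (n + m) '' {r | r ∈ (List.finRange m).map (linRow I)}) ≤
      Submodule.span (ZMod 2) (((usedCoords I).image ind : Finset (Vec (n + m))) : Set (Vec (n + m))) := by
    refine Submodule.span_le.2 ?_
    rintro _ ⟨r, hr, rfl⟩
    obtain ⟨j, -, rfl⟩ := List.mem_map.1 hr
    exact vecL_linRow_mem I j
  exact (Submodule.finrank_mono hle).trans ((finrank_span_finset_le_card _).trans (card_image_le.trans (card_usedCoords_le I)))

/-! ## Dependent rows are found -/

/-- **Among vectors in a subspace of dimension `≤ D`, one of the first `D + 1` lies in the span of the earlier ones.** -/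
theorem exists_mem_span_prev_of_finrank_le {N D : ℕ} (w : ℕ → Vec N) (W : Submodule (ZMod 2) (Vec N))
    (hw : ∀ t, w t ∈ W) (hD : Module.finrank (ZMod 2) W ≤ D) :
    ∃ t, t < D + 1 ∧ w t ∈ Submodule.span (ZMod 2) (w '' {s | s < t}) := by
  by_contra hcon
  push Not at hcon
  have key : ∀ K, K ≤ D + 1 → LinearIndependent (ZMod 2) (fun i : Fin K => w i.val) := by
    intro K
    induction K with
    | zero => intro _; exact linearIndependent_empty_type
    | succ K ih =>
      intro hK
      have hr : Set.range (fun i : Fin K => w i.val) = w '' {s | s < K} := by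
        ext v
        simp only [Set.mem_range, Set.mem_image, Set.mem_setOf_eq]
        constructor
        · rintro ⟨i, rfl⟩; exact ⟨i.val, i.isLt, rfl⟩
        · rintro ⟨s, hs, rfl⟩; exact ⟨⟨s, hs⟩, rfl⟩
      have hwK : w K ∉ Submodule.span (ZMod 2) (Set.range fun i : Fin K => w i.val) := by
        rw [hr]; exact hcon K (by omega)
      have h := (ih (by omega)).finSnoc hwK
      have he : (Fin.snoc (fun i : Fin K => w i.val) (w K) : Fin (K + 1) → Vec N) = fun i : Fin (K + 1) => w i.val := by
        funext i
        refine Fin.lastCases ?_ (fun i' => ?_) i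
        · rw [Fin.snoc_last, Fin.val_last]
        · rw [Fin.snoc_castSucc, Fin.val_castSucc]
      rwa [he] at h
  have hli := key (D + 1) le_rfl
  have h1 : Module.finrank (ZMod 2) (Submodule.span (ZMod 2) (Set.range fun i : Fin (D + 1) => w i.val)) = D + 1 := by
    rw [finrank_span_eq_card hli, Fintype.card_fin]
  have h2 : Submodule.span (ZMod 2) (Set.range fun i : Fin (D + 1) => w i.val) ≤ W := by
    refine Submodule.span_le.2 ?_
    rintro _ ⟨i, rfl⟩
    exact hw i
  have h3 := Submodule.finrank_mono h2
  omega

/-- **The span test finds a dependent row** among `≥ D + 1` rows spanning a space of dimension `≤ D`: `tStar` is a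
genuine position whose row lies in the span of the earlier rows (the tree's `AffineSplitFP.tStar_spec`, with the ambient
dimension replaced by the dimension of the row space). -/
theorem tStar_spec_of_finrank {N D : ℕ} (rows : List (List ℕ))
    (hD : Module.finrank (ZMod 2) (Submodule.span (ZMod 2) (vecL N '' {r | r ∈ rows})) ≤ D) (hlen : D + 1 ≤ rows.length) :
    tStar N rows < rows.length ∧ inSpan N (rows.take (tStar N rows)) (rows.getD (tStar N rows) []) = true := by
  have hw : ∀ s, vecL N (rows.getD s []) ∈ Submodule.span (ZMod 2) (vecL N '' {r | r ∈ rows}) := by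
    intro s
    by_cases hs : s < rows.length
    · refine Submodule.subset_span ⟨rows.getD s [], ?_, rfl⟩
      rw [List.getD_eq_getElem?_getD, List.getElem?_eq_getElem hs, Option.getD_some]
      exact List.getElem_mem _
    · rw [List.getD_eq_default _ _ (Nat.le_of_not_lt hs), vecL_nil]
      exact Submodule.zero_mem _
  obtain ⟨t, ht, hmem⟩ := exists_mem_span_prev_of_finrank_le (fun s => vecL N (rows.getD s [])) _ hw hD
  have hwit : inSpan N (rows.take t) (rows.getD t []) = true := by
    rw [inSpan_iff]
    refine Submodule.span_mono ?_ hmem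
    rintro _ ⟨s, hs, rfl⟩
    have hst : s < t := hs
    have hsl : s < rows.length := by omega
    refine ⟨rows.getD s [], ?_, rfl⟩
    rw [List.getD_eq_getElem?_getD, List.getElem?_eq_getElem hsl, Option.getD_some]
    have e : rows[s] = (rows.take t)[s]'(by rw [List.length_take]; omega) := (List.getElem_take).symm
    rw [e]; exact List.getElem_mem _
  have hlt : (List.range rows.length).findIdx (fun t => inSpan N (rows.take t) (rows.getD t [])) <
      (List.range rows.length).length :=
    List.findIdx_lt_length_of_exists ⟨t, List.mem_range.2 (by omega), hwit⟩
  have hp := List.findIdx_getElem (w := hlt)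
  rw [List.getElem_range] at hp
  rw [List.length_range] at hlt
  exact ⟨hlt, hp⟩

/-! ## Correctness -/

/-- The dependent output index of a linearisable instance is a genuine output whose row lies in the span of the
earlier rows. -/
theorem jL_spec (I : LocalMap 4 n m) (hm : n + numAndPairs I < m) :
    jL I < m ∧ inSpan (n + m) (((List.finRange m).map (linRow I)).take (jL I))
      (((List.finRange m).map (linRow I)).getD (jL I) []) = true := by
  have h := tStar_spec_of_finrank (N := n + m) ((List.finRange m).map (linRow I)) (finrank_rows_le I)
    (by rw [List.length_map, List.length_finRange]; omega)
  rw [List.length_map, List.length_finRange] at h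
  exact h

/-- **CORRECTNESS OF THE LINEARISATION MACHINE**: for a pure `P⋆` instance with `m > n + #{distinct AND pairs}` the
printed string `e_{j⋆}` is outside the range. -/
theorem linStr_correct (I : LocalMap 4 n m) (hI : I.IsPure xorAndPred) (hm : n + numAndPairs I < m) :
    readOut m (linStr I.encode) ∉ I.range := by
  rintro ⟨x, hx⟩
  obtain ⟨htm, hspan⟩ := jL_spec I hm
  -- the printed string
  have hy : ∀ j : Fin m, I.eval x j = (j.val == jL I) := fun j => by
    have h := congrFun hx j
    rwa [readOut_linStr] at h
  -- `z(x)` kills every other row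
  have hkill : ∀ j : Fin m, j.val ≠ jL I → zvec I x ⬝ᵥ vecL (n + m) (linRow I j) = 0 := by
    intro j hj
    rw [← bit_eval I hI x j, hy j, bit_eq_zero]
    exact beq_false_of_ne hj
  -- hence the dependent row
  have hrow : ((List.finRange m).map (linRow I)).getD (jL I) [] = linRow I ⟨jL I, htm⟩ := by
    rw [List.getD_eq_getElem?_getD, List.getElem?_map,
      List.getElem?_eq_getElem (by rw [List.length_finRange]; exact htm), Option.map_some, Option.getD_some,
      List.getElem_finRange]
    rfl
  have hzero : zvec I x ⬝ᵥ vecL (n + m) (linRow I ⟨jL I, htm⟩) = 0 := by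
    rw [← hrow]
    rw [inSpan_iff] at hspan
    refine dot_eq_zero_of_mem_span ?_ hspan
    rintro _ ⟨r, hr, rfl⟩
    obtain ⟨s, hsm, hst, rfl⟩ := mem_take_map (linRow I) (List.finRange m) (jL I) hr
    refine hkill _ ?_
    rw [List.getElem_finRange]
    exact Nat.ne_of_lt hst
  -- contradiction at the printed `1`
  have h1 := hy ⟨jL I, htm⟩
  rw [beq_self_eq_true] at h1
  have h2 := bit_eval I hI x ⟨jL I, htm⟩
  rw [hzero, h1] at h2
  exact absurd (bit_eq_zero.1 h2) (by decide)

end Summit.PneNP.PneNP.Theorems.PstarLinearisation
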